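import Mathlib
import HarnessLib

/-!
# `stub_mnIdentification` — registered stub of line `FilterInvariance`
# (crux `EmbeddedDrudeMourre.GreenKuboContinuation`, item stmt-AtomisticToContinuum-12597)

Target: directory `Summits/AtomisticToContinuum/FouriersLaw/Theorems/`, file
`EmbeddedDrudeMourreGreenKuboContinuationMnIdentification.lean`
(`ledger propose --supports stmt-AtomisticToContinuum-12597`). The theorem name and signature of
`stub_mnIdentification` are REGISTERED and stay verbatim.

## Content

Riesz identification on the open band: if a finite measure `τ` on `ℝ` and a function `g`,
continuous and positive on `I = (-1, 1)`, satisfy `∫ f dτ = ∫_I f g dx` for every continuous `f`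
with compact support inside `I`, then `τ|_I = g · dx|_I` as measures
(`τ.restrict I = (volume.restrict I).withDensity (ofReal ∘ g)`).

## Proof

* `mnId_exists_bump`: explicit plateau functions
  `f_k(x) = max 0 (min 1 (min (k (x - a) - 1) (k (b - x) - 1)))`, continuous, `[0, 1]`-valued,
  compactly supported inside `(a, b)`, monotone in `k`, eventually equal to the indicator of
  `(a, b)` at every point.
* `mnId_measure_Ioo_eq`: for `(a, b) ⊆ I`, test the hypothesis on `f_k`, pass to `ℝ≥0∞`
  (`ofReal_integral_eq_lintegral_ofReal`; `f_k g` is bounded since `g` is bounded on the compact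
  support of `f_k`), and let `k → ∞` on both sides by monotone convergence
  (`lintegral_tendsto_of_tendsto_of_monotone`): `τ (a, b) = ∫⁻_{(a,b)} ofReal (g x) dx`.
* `stub_mnIdentification`: two measures on `ℝ` that agree on all open intervals with rational
  endpoints, the first locally finite, are equal (`Real.measure_ext_Ioo_rat`); both sides live on
  `I`, and `(p, q) ∩ I = (max p (-1), min q 1)`.

Nothing is used about `g` outside `I` (it is only ever integrated against `volume.restrict I` or
over subintervals of `I`).
-/

noncomputable section

namespace Summit.AtomisticToContinuum.FouriersLaw.Theorems.GreenKuboContinuation.BandLimitedKrylov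

open Filter Topology MeasureTheory Set Polynomial

namespace MnIdentification

/-- **Plateau bumps exhausting an open interval.** For reals `a b` there are continuous functions
`f_k : ℝ → ℝ` (`k : ℕ`), with values in `[0, 1]`, compactly supported with `tsupport f_k ⊆ (a, b)`,
pointwise monotone in `k`, and eventually equal, at every point, to the indicator of `(a, b)`.
Explicitly `f_k(x) = max 0 (min 1 (min (k (x - a) - 1) (k (b - x) - 1)))`. [folklore] -/
theorem mnId_exists_bump (a b : ℝ) :
    ∃ f : ℕ → ℝ → ℝ,
      (∀ k, Continuous (f k)) ∧ (∀ k x, 0 ≤ f k x) ∧ (∀ k x, f k x ≤ 1) ∧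
      (∀ k, tsupport (f k) ⊆ Ioo a b) ∧ (∀ k, HasCompactSupport (f k)) ∧
      (∀ x, Monotone fun k => f k x) ∧
      (∀ x, ∃ N : ℕ, ∀ k ≥ N, f k x = (Ioo a b).indicator 1 x) := by
  -- two shared facts about the explicit formula
  have hzero : ∀ (k : ℕ) (x : ℝ), x ∉ Ioo a b →
      max 0 (min 1 (min ((k : ℝ) * (x - a) - 1) ((k : ℝ) * (b - x) - 1))) = 0 := by
    intro k x hx
    have hk : (0 : ℝ) ≤ k := k.cast_nonneg
    rw [mem_Ioo, not_and_or, not_lt, not_lt] at hx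
    apply max_eq_left
    rcases hx with h | h
    · have : (k : ℝ) * (x - a) ≤ 0 := mul_nonpos_of_nonneg_of_nonpos hk (by linarith)
      exact (min_le_right _ _).trans ((min_le_left _ _).trans (by linarith))
    · have : (k : ℝ) * (b - x) ≤ 0 := mul_nonpos_of_nonneg_of_nonpos hk (by linarith)
      exact (min_le_right _ _).trans ((min_le_right _ _).trans (by linarith))
  have hK : ∀ k : ℕ, ∃ K : Set ℝ, IsCompact K ∧ K ⊆ Ioo a b ∧
      tsupport (fun x => max 0 (min 1 (min ((k : ℝ) * (x - a) - 1) ((k : ℝ) * (b - x) - 1)))) ⊆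
        K := by
    intro k
    have hk : (0 : ℝ) ≤ k := k.cast_nonneg
    have hclosed : IsClosed ({x : ℝ | 1 ≤ (k : ℝ) * (x - a)} ∩ {x : ℝ | 1 ≤ (k : ℝ) * (b - x)}) :=
      (isClosed_le continuous_const (by fun_prop)).inter
        (isClosed_le continuous_const (by fun_prop))
    have hsub : {x : ℝ | 1 ≤ (k : ℝ) * (x - a)} ∩ {x : ℝ | 1 ≤ (k : ℝ) * (b - x)} ⊆ Ioo a b := by
      rintro x ⟨h1, h2⟩
      simp only [mem_setOf_eq] at h1 h2
      constructor
      · by_contra h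
        have : (k : ℝ) * (x - a) ≤ 0 := mul_nonpos_of_nonneg_of_nonpos hk (by linarith)
        linarith
      · by_contra h
        have : (k : ℝ) * (b - x) ≤ 0 := mul_nonpos_of_nonneg_of_nonpos hk (by linarith)
        linarith
    refine ⟨_, isCompact_Icc.of_isClosed_subset hclosed (hsub.trans Ioo_subset_Icc_self), hsub,
      hclosed.closure_subset_iff.2 fun x hx => ?_⟩
    rw [Function.mem_support] at hx
    by_contra hxK
    simp only [mem_inter_iff, mem_setOf_eq, not_and_or, not_le] at hxK
    apply hx
    apply max_eq_left
    rcases hxK with h | h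
    · exact (min_le_right _ _).trans ((min_le_left _ _).trans (by linarith))
    · exact (min_le_right _ _).trans ((min_le_right _ _).trans (by linarith))
  refine ⟨fun k x => max 0 (min 1 (min ((k : ℝ) * (x - a) - 1) ((k : ℝ) * (b - x) - 1))),
    fun k => by fun_prop, fun k x => le_max_left _ _,
    fun k x => max_le zero_le_one (min_le_left _ _), fun k => ?_, fun k => ?_, fun x => ?_,
    fun x => ?_⟩
  · obtain ⟨K, -, hKsub, hts⟩ := hK k
    exact hts.trans hKsub
  · obtain ⟨K, hKc, -, hts⟩ := hK k
    exact hKc.of_isClosed_subset (isClosed_tsupport _) hts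
  · intro m n hmn
    dsimp only
    by_cases hx : x ∈ Ioo a b
    · have h1 : (m : ℝ) ≤ n := Nat.cast_le.2 hmn
      have hxa : 0 ≤ x - a := (sub_pos.2 hx.1).le
      have hbx : 0 ≤ b - x := (sub_pos.2 hx.2).le
      exact max_le_max le_rfl (min_le_min le_rfl (min_le_min
        (sub_le_sub_right (mul_le_mul_of_nonneg_right h1 hxa) _)
        (sub_le_sub_right (mul_le_mul_of_nonneg_right h1 hbx) _)))
    · rw [hzero m x hx, hzero n x hx]
  · by_cases hx : x ∈ Ioo a b
    · obtain ⟨N, hN⟩ := exists_nat_ge (max (2 / (x - a)) (2 / (b - x)))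
      refine ⟨N, fun k hk => ?_⟩
      have hxa : 0 < x - a := sub_pos.2 hx.1
      have hbx : 0 < b - x := sub_pos.2 hx.2
      have hkN : (N : ℝ) ≤ k := Nat.cast_le.2 hk
      have h1 : 2 ≤ (k : ℝ) * (x - a) := by
        have : 2 / (x - a) ≤ k := (le_max_left _ _).trans (hN.trans hkN)
        rwa [div_le_iff₀ hxa] at this
      have h2 : 2 ≤ (k : ℝ) * (b - x) := by
        have : 2 / (b - x) ≤ k := (le_max_right _ _).trans (hN.trans hkN)
        rwa [div_le_iff₀ hbx] at this
      dsimp only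
      rw [indicator_of_mem hx, Pi.one_apply, min_eq_left (le_min (by linarith) (by linarith)),
        max_eq_right zero_le_one]
    · exact ⟨0, fun k _ => by
        dsimp only
        rw [indicator_of_notMem hx, hzero k x hx]⟩

/-- **Open subintervals.** Under the hypotheses of `stub_mnIdentification` (finite `τ`; `g`
continuous and positive on `I = (-1, 1)`; `∫ f dτ = ∫_I f g dx` for continuous `f` compactly
supported inside `I`), every open interval `(a, b) ⊆ I` has
`τ (a, b) = ∫⁻_{(a, b)} ofReal (g x) d(volume|_I)`: test on the plateau bumps of
`mnId_exists_bump`, pass to `ℝ≥0∞` and let `k → ∞` by monotone convergence on both sides.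
[folklore] -/
theorem mnId_measure_Ioo_eq {τ : Measure ℝ} [IsFiniteMeasure τ] {g : ℝ → ℝ}
    (hg : ContinuousOn g (Ioo (-1) 1)) (hpos : ∀ x ∈ Ioo (-1 : ℝ) 1, 0 < g x)
    (hfg : ∀ f : ℝ → ℝ, Continuous f → HasCompactSupport f → tsupport f ⊆ Ioo (-1) 1 →
      ∫ ω, f ω ∂τ = ∫ x in Ioo (-1 : ℝ) 1, f x * g x)
    {a b : ℝ} (hab : Ioo a b ⊆ Ioo (-1) 1) :
    τ (Ioo a b) = ∫⁻ x in Ioo a b, ENNReal.ofReal (g x) ∂(volume.restrict (Ioo (-1) 1)) := by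
  obtain ⟨f, hcont, hnn, hle, hsupp, hcpt, hmono, hlim⟩ := mnId_exists_bump a b
  set ρ : Measure ℝ := volume.restrict (Ioo (-1 : ℝ) 1)
  have hmem : ∀ᵐ x ∂ρ, x ∈ Ioo (-1 : ℝ) 1 := ae_restrict_mem measurableSet_Ioo
  have hgm : AEStronglyMeasurable g ρ := hg.aestronglyMeasurable measurableSet_Ioo
  -- Step 1: `f k * g` is integrable with respect to `ρ` (bounded, `ρ` finite)
  have hint : ∀ k, Integrable (fun x => f k x * g x) ρ := by
    intro k
    obtain ⟨C, hC⟩ :=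
      (hcpt k).isCompact.exists_bound_of_continuousOn (hg.mono ((hsupp k).trans hab))
    refine Integrable.of_bound ((hcont k).aestronglyMeasurable.mul hgm) (max C 0)
      (ae_of_all _ fun x => ?_)
    by_cases hx : x ∈ tsupport (f k)
    · rw [norm_mul]
      calc ‖f k x‖ * ‖g x‖ ≤ 1 * C :=
            mul_le_mul (by rw [Real.norm_eq_abs, abs_of_nonneg (hnn k x)]; exact hle k x)
              (hC x hx) (norm_nonneg _) zero_le_one
        _ ≤ max C 0 := by rw [one_mul]; exact le_max_left _ _
    · rw [image_eq_zero_of_notMem_tsupport hx, zero_mul, norm_zero]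
      exact le_max_right _ _
  -- Step 2: the termwise identity, in `ℝ≥0∞`
  have hk : ∀ k, ∫⁻ x, ENNReal.ofReal (f k x) ∂τ = ∫⁻ x, ENNReal.ofReal (f k x * g x) ∂ρ := by
    intro k
    have hnn' : 0 ≤ᵐ[ρ] fun x => f k x * g x := by
      filter_upwards [hmem] with x hx
      exact mul_nonneg (hnn k x) (hpos x hx).le
    rw [← ofReal_integral_eq_lintegral_ofReal ((hcont k).integrable_of_hasCompactSupport (hcpt k))
        (ae_of_all _ (hnn k)), ← ofReal_integral_eq_lintegral_ofReal (hint k) hnn',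
      hfg (f k) (hcont k) (hcpt k) ((hsupp k).trans hab)]
  -- Step 3: `k → ∞` on both sides (monotone convergence)
  have hlimL : Tendsto (fun k => ∫⁻ x, ENNReal.ofReal (f k x) ∂τ) atTop
      (𝓝 (∫⁻ x, (Ioo a b).indicator 1 x ∂τ)) := by
    refine lintegral_tendsto_of_tendsto_of_monotone
      (fun k => (hcont k).measurable.ennreal_ofReal.aemeasurable)
      (ae_of_all _ fun x m n hmn => ENNReal.ofReal_le_ofReal (hmono x hmn))
      (ae_of_all _ fun x => ?_)
    obtain ⟨N, hN⟩ := hlim x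
    refine tendsto_atTop_of_eventually_const (i₀ := N) fun k hk => ?_
    rw [hN k hk]
    by_cases hx : x ∈ Ioo a b
    · simp only [indicator_of_mem hx, Pi.one_apply, ENNReal.ofReal_one]
    · simp only [indicator_of_notMem hx, ENNReal.ofReal_zero]
  have hlimR : Tendsto (fun k => ∫⁻ x, ENNReal.ofReal (f k x * g x) ∂ρ) atTop
      (𝓝 (∫⁻ x, (Ioo a b).indicator (fun y => ENNReal.ofReal (g y)) x ∂ρ)) := by
    refine lintegral_tendsto_of_tendsto_of_monotone
      (fun k => ((hcont k).aestronglyMeasurable.mul hgm).aemeasurable.ennreal_ofReal) ?_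
      (ae_of_all _ fun x => ?_)
    · filter_upwards [hmem] with x hx
      intro m n hmn
      exact ENNReal.ofReal_le_ofReal (mul_le_mul_of_nonneg_right (hmono x hmn) (hpos x hx).le)
    · obtain ⟨N, hN⟩ := hlim x
      refine tendsto_atTop_of_eventually_const (i₀ := N) fun k hk => ?_
      rw [hN k hk]
      by_cases hx : x ∈ Ioo a b
      · simp only [indicator_of_mem hx, Pi.one_apply, one_mul]
      · simp only [indicator_of_notMem hx, zero_mul, ENNReal.ofReal_zero]
  -- Step 4: identify the two limits
  have hfun : (fun k => ∫⁻ x, ENNReal.ofReal (f k x) ∂τ) =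
      fun k => ∫⁻ x, ENNReal.ofReal (f k x * g x) ∂ρ := funext hk
  rw [hfun] at hlimL
  have heq := tendsto_nhds_unique hlimL hlimR
  rwa [lintegral_indicator_one measurableSet_Ioo, lintegral_indicator measurableSet_Ioo] at heq

end MnIdentification

/-- **`stub_mnIdentification` — Riesz identification on the open band.** If a finite measure `τ`
and a function `g`, continuous and strictly positive on `(-1, 1)`, integrate every continuous `f`
compactly supported inside `(-1, 1)` alike, `∫ f dτ = ∫_{(-1,1)} f g dx`, then
`τ|_{(-1,1)} = g dx|_{(-1,1)}` (monotone approximation of indicators of open intervals by such `f`,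
`MnIdentification.mnId_measure_Ioo_eq`; two measures on `ℝ` agreeing on open intervals with
rational endpoints, the left one locally finite, coincide — `Real.measure_ext_Ioo_rat`; both sides
live on `(-1, 1)` and `(p, q) ∩ (-1, 1) = (max p (-1), min q 1)`). [folklore] -/
theorem stub_mnIdentification :
    ∀ (τ : Measure ℝ), IsFiniteMeasure τ →
      ∀ g : ℝ → ℝ, ContinuousOn g (Set.Ioo (-1) 1) → (∀ x ∈ Set.Ioo (-1 : ℝ) 1, 0 < g x) →
        (∀ f : ℝ → ℝ, Continuous f → HasCompactSupport f → tsupport f ⊆ Set.Ioo (-1) 1 →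
          ∫ ω, f ω ∂τ = ∫ x in Set.Ioo (-1 : ℝ) 1, f x * g x) →
        τ.restrict (Set.Ioo (-1) 1) =
          (volume.restrict (Set.Ioo (-1) 1)).withDensity (fun x => ENNReal.ofReal (g x)) := by
  intro τ hfin g hg hpos hfg
  refine Real.measure_ext_Ioo_rat (μ := τ.restrict (Ioo (-1) 1)) fun p q => ?_
  have hinter : Ioo (p : ℝ) q ∩ Ioo (-1) 1 = Ioo (max (p : ℝ) (-1)) (min (q : ℝ) 1) :=
    Ioo_inter_Ioo
  have hsub : Ioo (max (p : ℝ) (-1)) (min (q : ℝ) 1) ⊆ Ioo (-1) 1 := by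
    rw [← hinter]
    exact inter_subset_right
  rw [Measure.restrict_apply measurableSet_Ioo, withDensity_apply _ measurableSet_Ioo,
    Measure.restrict_restrict measurableSet_Ioo, hinter,
    MnIdentification.mnId_measure_Ioo_eq hg hpos hfg hsub,
    Measure.restrict_restrict measurableSet_Ioo, inter_eq_left.2 hsub]


end Summit.AtomisticToContinuum.FouriersLaw.Theorems.GreenKuboContinuation.BandLimitedKrylov

end
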